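import Summits.ResolutionOfSingularities.ResolutionOfSingularities.Theorems.MarkedTransferCampaignW32WQTopLocus
import HarnessLib

/-!
# Kill test K3.2′ (slot W3.2, variant (V-a) riso / rtd), ADDENDUM A2 — the gradient table at the three arcs near P ∈ Γ₂ of the W-Q fourfold

Cell `res-hironaka`, seat `res-L1-k32` gen 3; report `L/res-L1-k32/KILL-TEST-K3.2prime.md` §9 (hand proof that `rtd_0(X₂) = rtd_P(X₂) = 0`
over the definitions of Monreal, arXiv:2606.12554). **[OURS · L1 W3.2] elementary polynomial identities; NOT a statement of the manuscript**
([claim: Hironaka2017, status: under-review]; D-0012/D-0089). AI-produced, weaker than expert review.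

What is certified: the integer values of the three first partial derivatives `Dy = ∂_y fW`, `Dz = ∂_z fW`, `Dw = ∂_w fW` of the K3.2 witness
`fW2 = x² + wv⁶ + zw⁵v² + yz²wv⁴ + yz³w⁵ + yz⁹ + y⁴zw²v² + y¹¹` (`…Theorems.CampaignW32WQTopLocus`, p466457; `∂_x fW = 2x`, `∂_v fW = 2·Dv2`
vanish in characteristic 2) along the three one-parameter families of points `r = r_P + ρ`, `r_P = (·, 0, 1, 1, 0)`, `ρ ∈ {(0,0,t,0), (t,0,0,0),
(0,0,0,t)}` (coordinates `(x; y, z, w, v) = (X 0; X 1, …, X 4)`; the parameter `t` is written `X 0` of the target ring). Each value is displayed as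
`(representative mod 2) + 2·(…)`, so in characteristic 2 the gradient vectors `(∂_y, ∂_z, ∂_w, ∂_v) fW (r)` are `(t + t⁴ + t⁵, 0, 0, 0)`,
`(t¹⁰, 0, t, 0)`, `(t⁴, t², t² + t⁶, 0)` — the table of §9.4 of the report.

How it is read (report §9, hand steps over Monreal Def 3.9/3.14/3.15/3.17, Ex 3.11, Rem 3.16): over the perfect field `K = k((t^ℚ))` of
characteristic 2 the arcs of `X₂ = V(fW)` based at `P = (0,0,1,1,0)` are `(G(r), r²)` with `r ∈ r_P + 𝔪⁴` (`x = √G(q) = G(√q)`), and the leading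
gradient direction `ℓ̄_a` of `∂G(r_a)` at a NON-singular arc `a` confines every riso-triviality direction to `k·e_x ⊕ (0 ⊕ Frob ker ℓ̄_a)` (lemma L3);
the three families above give `ℓ̄ ∝ e_y*, e_w*, e_z* + e_w*`, whose kernels meet in `k·e_v`, while the singular branch `Γ₂` through `P` forces the
direction `e_z` (lemma L2): hence `rtd_P(X₂) = 0` (and `rtd_0(X₂) = 0` from the branches `w`-axis / `Γ₂` at `0`), so the riso datum does NOT separate the
K3.2 pair — (V-a) DEAD by the pre-registered grammar. NOT formalised: arcs, risometries, `rtd`, the lemmas L1–L3.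
-/

set_option linter.dupNamespace false -- mandated namespace of this single-conjunct summit

namespace Summit.ResolutionOfSingularities.ResolutionOfSingularities.Theorems.CampaignW32.K32PrimeRiso

open MvPolynomial
open Summit.ResolutionOfSingularities.ResolutionOfSingularities.Theorems.CampaignW32WQTopLocus (Dy Dz Dw)

variable {R : Type*} [CommRing R]

/-! ## Arc family ρ = (0,0,t,0): r = (·, 0, 1, 1 + t, 0) -/

/-- `∂_y fW (·,0,1,1+t,0) = t + t⁴ + t⁵ + 2·(1 + 2t + 5t² + 5t³ + 2t⁴)` — in characteristic 2: `t + t⁴ + t⁵` (leading direction `e_y*`). [OURS · L1 W3.2 · K3.2′ §9] elementary; NOT a statement of the manuscript. -/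
theorem arcPw_Dy :
    bind₁ (![0, 0, 1, 1 + X 0, 0] : Fin 5 → MvPolynomial (Fin 5) R) Dy
      = X 0 + X 0 ^ 4 + X 0 ^ 5 + 2 * (1 + 2 * X 0 + 5 * X 0 ^ 2 + 5 * X 0 ^ 3 + 2 * X 0 ^ 4) := by
  simp only [Dy, map_add, map_mul, map_pow, map_ofNat, bind₁_X_right, Matrix.cons_val_zero, Matrix.cons_val_one,
    Matrix.cons_val]
  ring

/-- `∂_z fW (·,0,1,1+t,0) = 0`. [OURS · L1 W3.2 · K3.2′ §9] elementary. -/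
theorem arcPw_Dz : bind₁ (![0, 0, 1, 1 + X 0, 0] : Fin 5 → MvPolynomial (Fin 5) R) Dz = 0 := by
  simp only [Dz, map_add, map_mul, map_pow, map_ofNat, bind₁_X_right, Matrix.cons_val_zero, Matrix.cons_val_one,
    Matrix.cons_val]
  ring

/-- `∂_w fW (·,0,1,1+t,0) = 0`. [OURS · L1 W3.2 · K3.2′ §9] elementary. -/
theorem arcPw_Dw : bind₁ (![0, 0, 1, 1 + X 0, 0] : Fin 5 → MvPolynomial (Fin 5) R) Dw = 0 := by
  simp only [Dw, map_add, map_mul, map_pow, map_ofNat, bind₁_X_right, Matrix.cons_val_zero, Matrix.cons_val_one,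
    Matrix.cons_val]
  ring

/-! ## Arc family ρ = (t,0,0,0): r = (·, t, 1, 1, 0) -/

/-- `∂_y fW (·,t,1,1,0) = t¹⁰ + 2·(1 + 5t¹⁰)` — in characteristic 2: `t¹⁰`. [OURS · L1 W3.2 · K3.2′ §9] elementary. -/
theorem arcPy_Dy :
    bind₁ (![0, X 0, 1, 1, 0] : Fin 5 → MvPolynomial (Fin 5) R) Dy = X 0 ^ 10 + 2 * (1 + 5 * X 0 ^ 10) := by
  simp only [Dy, map_add, map_mul, map_pow, map_ofNat, bind₁_X_right, Matrix.cons_val_zero, Matrix.cons_val_one,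
    Matrix.cons_val]
  ring

/-- `∂_z fW (·,t,1,1,0) = 12t = 2·(6t)` — vanishes in characteristic 2. [OURS · L1 W3.2 · K3.2′ §9] elementary. -/
theorem arcPy_Dz : bind₁ (![0, X 0, 1, 1, 0] : Fin 5 → MvPolynomial (Fin 5) R) Dz = 2 * (6 * X 0) := by
  simp only [Dz, map_add, map_mul, map_pow, map_ofNat, bind₁_X_right, Matrix.cons_val_zero, Matrix.cons_val_one,
    Matrix.cons_val]
  ring

/-- `∂_w fW (·,t,1,1,0) = 5t = t + 2·(2t)` — in characteristic 2: `t` (with `arcPy_Dy`: leading direction `e_w*`, since `v(t) < v(t¹⁰)`). [OURS · L1 W3.2 · K3.2′ §9] elementary. -/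
theorem arcPy_Dw : bind₁ (![0, X 0, 1, 1, 0] : Fin 5 → MvPolynomial (Fin 5) R) Dw = X 0 + 2 * (2 * X 0) := by
  simp only [Dw, map_add, map_mul, map_pow, map_ofNat, bind₁_X_right, Matrix.cons_val_zero, Matrix.cons_val_one,
    Matrix.cons_val]
  ring

/-! ## Arc family ρ = (0,0,0,t): r = (·, 0, 1, 1, t) -/

/-- `∂_y fW (·,0,1,1,t) = t⁴ + 2` — in characteristic 2: `t⁴`. [OURS · L1 W3.2 · K3.2′ §9] elementary. -/
theorem arcPv_Dy : bind₁ (![0, 0, 1, 1, X 0] : Fin 5 → MvPolynomial (Fin 5) R) Dy = X 0 ^ 4 + 2 := by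
  simp only [Dy, map_add, map_mul, map_pow, map_ofNat, bind₁_X_right, Matrix.cons_val_zero, Matrix.cons_val_one,
    Matrix.cons_val]
  ring

/-- `∂_z fW (·,0,1,1,t) = t²`. [OURS · L1 W3.2 · K3.2′ §9] elementary. -/
theorem arcPv_Dz : bind₁ (![0, 0, 1, 1, X 0] : Fin 5 → MvPolynomial (Fin 5) R) Dz = X 0 ^ 2 := by
  simp only [Dz, map_add, map_mul, map_pow, map_ofNat, bind₁_X_right, Matrix.cons_val_zero, Matrix.cons_val_one,
    Matrix.cons_val]
  ring

/-- `∂_w fW (·,0,1,1,t) = t² + t⁶ + 2·(2t²)` — in characteristic 2: `t² + t⁶` (with `arcPv_Dy/Dz`: leading direction `e_z* + e_w*` at valuation `2v(t)`). [OURS · L1 W3.2 · K3.2′ §9] elementary. -/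
theorem arcPv_Dw : bind₁ (![0, 0, 1, 1, X 0] : Fin 5 → MvPolynomial (Fin 5) R) Dw = X 0 ^ 2 + X 0 ^ 6 + 2 * (2 * X 0 ^ 2) := by
  simp only [Dw, map_add, map_mul, map_pow, map_ofNat, bind₁_X_right, Matrix.cons_val_zero, Matrix.cons_val_one,
    Matrix.cons_val]
  ring

end Summit.ResolutionOfSingularities.ResolutionOfSingularities.Theorems.CampaignW32.K32PrimeRiso
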